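import Summits.ResolutionOfSingularities.ResolutionOfSingularities.Theorems.PurelyInseparableDim4FreeTailLemma
import HarnessLib
import HarnessLib.Audit.Tags

/-!
# Purely inseparable four-folds — LETTER-CHANGE COMBINATORICS for the C∞ assembly
# (cell `res-dim4-pi`, K2(p) lane, slice B, brick K24c layer 2b, first step)

[OURS · counted 0 · cell `res-dim4-pi` · K2(p) lane holder res-dim4-p-12 g3 (bus 2026-08-29 03:02Z) and K24c
owner res-dim4-p-3 g3 (03:05Z: «both letters recur on an infinite two-slot play, else ¬IsSatellite tail»);
seat res-dim4-p-9 g3.]  Nothing here proves K2(p)/K2(5), `NoIsolatedTrap p p` or resolution of singularities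
in dimension ≥ 4 / characteristic `p`.  Pure bookkeeping that lets the C∞ assembly (K24c L2b) PICK A LATE
LETTER CHANGE `λμ` on an all-isolated witnessed chain whose chart letters live in two slots — the state at
which the frame is re-built (holder's design (iii)) and `CInfGame.Window.no_play_after_change` is played:

* `exists_change_of_not_eventuallyConst` (LC1): a sequence that is not eventually constant changes beyond
  every `N`;
* `exists_ordered_change` (LC2): if moreover `j k ∈ {lam, mu}` from `k₁` on, the ORDERED change
  `j k = lam, j (k+1) = mu` happens beyond every `N` (after a `mu → lam` change the first return to `mu` is a
  `lam → mu` change);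
* `false_of_eventuallyConst_chart` (LC3): an all-isolated witnessed chain cannot have an eventually constant
  chart letter — a constant tail is never a satellite step, and the FREE-TAIL theorem
  `FreeTailProof.noIsolatedFreeTailAt_self` produces a non-isolated state;
* `exists_letter_change_of_isolated_two_slot` (LC4 = LC2 + LC3): on an all-isolated witnessed chain with
  chart letters in `{lam, mu}` from `k₁` on, the change `lam μ`… precisely `j k = lam ∧ j (k + 1) = mu` occurs
  at arbitrarily late `k` (and so does the mirror change, by swapping the names).

bears_on: LADDER-RESOLUTION:D157-DOOR2 (res-dim4-pi · K2(p) · slice B · K24c L2b letter change).  Supports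
stmt-ResolutionOfSingularities-16155 (helper).
-/

set_option linter.dupNamespace false -- mandated namespace of this single-conjunct summit

namespace Summit.ResolutionOfSingularities.ResolutionOfSingularities.Theorems.PIDim4

namespace ResCone

open MvPolynomial
open Literature.AlgebraicGeometry.Resolution
open Literature.AlgebraicGeometry.Resolution.CentreBlowup
open Literature.AlgebraicGeometry.Resolution.Hauser2010
open Literature.AlgebraicGeometry.Resolution.HauserPerlega2019

/-- **LC1.** A sequence that is not eventually constant changes beyond every `N`. [folklore] -/
theorem exists_change_of_not_eventuallyConst {α : Type*} {j : ℕ → α}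
    (h : ¬ ∃ k₂, ∀ k, k₂ ≤ k → j (k + 1) = j k) (N : ℕ) : ∃ k, N ≤ k ∧ j (k + 1) ≠ j k := by
  by_contra hc
  push Not at hc
  exact h ⟨N, hc⟩

/-- **LC2. Ordered change in a two-slot sequence.**  If `j k ∈ {lam, mu}` for `k ≥ k₁` and `j` is not
eventually constant, then `j k = lam ∧ j (k + 1) = mu` for some `k ≥ N`, for every `N`: take any change beyond
`max N k₁`; if it is `mu → lam`, the first later index carrying `mu` is preceded by `lam`. [folklore] -/
theorem exists_ordered_change {α : Type*} {j : ℕ → α} {lam mu : α} {k₁ : ℕ}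
    (hslot : ∀ k, k₁ ≤ k → j k = lam ∨ j k = mu)
    (h : ¬ ∃ k₂, ∀ k, k₂ ≤ k → j (k + 1) = j k) (N : ℕ) :
    ∃ k, N ≤ k ∧ j k = lam ∧ j (k + 1) = mu := by
  classical
  obtain ⟨k, hk, hne⟩ := exists_change_of_not_eventuallyConst h (max N k₁)
  have hkN : N ≤ k := le_trans (le_max_left N k₁) hk
  have hk₁ : k₁ ≤ k := le_trans (le_max_right N k₁) hk
  rcases hslot k hk₁ with hkl | hkm
  · rcases hslot (k + 1) (by omega) with h1 | h1
    · exact absurd (h1.trans hkl.symm) hne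
    · exact ⟨k, hkN, hkl, h1⟩
  · have hk1 : j (k + 1) = lam :=
      (hslot (k + 1) (by omega)).resolve_right fun h' => hne (h'.trans hkm.symm)
    have hlm : lam ≠ mu := fun h' => hne (by rw [hk1, hkm, h'])
    obtain ⟨k', hk', hne'⟩ := exists_change_of_not_eventuallyConst h (k + 1)
    have hex : ∃ m, k + 1 ≤ m ∧ j m = mu := by
      rcases hslot k' (by omega) with h1 | h1
      · rcases hslot (k' + 1) (by omega) with h2 | h2
        · exact absurd (h2.trans h1.symm) hne'
        · exact ⟨k' + 1, by omega, h2⟩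
      · exact ⟨k', hk', h1⟩
    have hm := Nat.find_spec hex
    have hmin : ∀ m', m' < Nat.find hex → ¬ (k + 1 ≤ m' ∧ j m' = mu) := fun m' hm' => Nat.find_min hex hm'
    have hm2 : k + 2 ≤ Nat.find hex := by
      by_contra h'
      have heq : Nat.find hex = k + 1 := by omega
      exact hlm (hk1.symm.trans (by rw [← heq]; exact hm.2))
    refine ⟨Nat.find hex - 1, by omega, ?_, ?_⟩
    · rcases hslot (Nat.find hex - 1) (by omega) with h2 | h2
      · exact h2
      · exact absurd ⟨by omega, h2⟩ (hmin _ (by omega))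
    · rw [show Nat.find hex - 1 + 1 = Nat.find hex from by omega]
      exact hm.2

/-- **LC3. No eventually constant chart on an all-isolated witnessed chain.**  A constant tail has no
satellite step, so the free-tail theorem `FreeTailProof.noIsolatedFreeTailAt_self` yields a non-isolated
state. [OURS · bookkeeping] [folklore] -/
theorem false_of_eventuallyConst_chart (p : ℕ) [Fact p.Prime] {K : Type} [Field K] [CharP K p]
    [DecidableEq K] {c : ℕ → State K} {j : ℕ → Fin 4} {b : ℕ → Fin 4 → K}
    (hw : FreeTail.IsWitnessedChain p c j b) (hiso : ∀ k, IsIsolated p (c k).F)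
    (hconst : ∃ k₂, ∀ k, k₂ ≤ k → j (k + 1) = j k) : False := by
  obtain ⟨k₂, hk₂⟩ := hconst
  obtain ⟨k, hk⟩ := FreeTailProof.noIsolatedFreeTailAt_self p K c j b k₂ hw
    (fun k hk hsat => hsat.1 (hk₂ k hk))
  exact hk (hiso k)

/-- **LC4. A late ordered letter change exists.**  On an all-isolated witnessed chain whose chart letters
lie in `{lam, mu}` from `k₁` on, `j k = lam ∧ j (k + 1) = mu` holds at arbitrarily late `k` (for the mirror
change swap the names: `hslot` is symmetric). [OURS · bookkeeping] [folklore] -/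
theorem exists_letter_change_of_isolated_two_slot (p : ℕ) [Fact p.Prime] {K : Type} [Field K]
    [CharP K p] [DecidableEq K] {c : ℕ → State K} {j : ℕ → Fin 4} {b : ℕ → Fin 4 → K}
    (hw : FreeTail.IsWitnessedChain p c j b) (hiso : ∀ k, IsIsolated p (c k).F)
    {lam mu : Fin 4} {k₁ : ℕ} (hslot : ∀ k, k₁ ≤ k → j k = lam ∨ j k = mu) (N : ℕ) :
    ∃ k, N ≤ k ∧ j k = lam ∧ j (k + 1) = mu :=
  exists_ordered_change hslot (fun hconst => false_of_eventuallyConst_chart p hw hiso hconst) N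

/-- **LC4′. The two slot letters are distinct and both recur** (convenience form for the assembly): under the
same hypotheses `lam ≠ mu`, and beyond every `N` there are a `lam → mu` change and a `mu → lam` change.
[OURS · bookkeeping] [folklore] -/
theorem letter_changes_of_isolated_two_slot (p : ℕ) [Fact p.Prime] {K : Type} [Field K]
    [CharP K p] [DecidableEq K] {c : ℕ → State K} {j : ℕ → Fin 4} {b : ℕ → Fin 4 → K}
    (hw : FreeTail.IsWitnessedChain p c j b) (hiso : ∀ k, IsIsolated p (c k).F)
    {lam mu : Fin 4} {k₁ : ℕ} (hslot : ∀ k, k₁ ≤ k → j k = lam ∨ j k = mu) (N : ℕ) :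
    lam ≠ mu ∧ (∃ k, N ≤ k ∧ j k = lam ∧ j (k + 1) = mu) ∧ (∃ k, N ≤ k ∧ j k = mu ∧ j (k + 1) = lam) := by
  obtain ⟨k, hk, hl, hm⟩ := exists_letter_change_of_isolated_two_slot p hw hiso hslot N
  refine ⟨fun h => ?_, ⟨k, hk, hl, hm⟩,
    exists_letter_change_of_isolated_two_slot p hw hiso (fun k hk => (hslot k hk).symm) N⟩
  exact false_of_eventuallyConst_chart p hw hiso
    ⟨k₁, fun k' hk' => by
      rcases hslot k' hk' with h1 | h1 <;> rcases hslot (k' + 1) (by omega) with h2 | h2 <;>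
        simp [h1, h2, h]⟩

end ResCone

end Summit.ResolutionOfSingularities.ResolutionOfSingularities.Theorems.PIDim4
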